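import Literature.MathematicalPhysics.QuantumFieldTheory.Balaban1983to89.B15Prop1SliceNondegeneracyFromRealCoercive
import Literature.MathematicalPhysics.QuantumFieldTheory.Balaban1983to89.B15Prop1MinimiserFromBaseUniqueness
import Literature.MathematicalPhysics.QuantumFieldTheory.Balaban1983to89.B15Prop1ClassOpenAtRecord
import Literature.MathematicalPhysics.QuantumFieldTheory.Balaban1983to89.B14Eq16FaddeevPopov
import Literature.MathematicalPhysics.QuantumFieldTheory.Balaban1983to89.B16Thm1BaseAtRecord11
import Literature.MathematicalPhysics.QuantumFieldTheory.Balaban1983to89.B12ContinuousTransportInvariance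
import Literature.Analysis.Calculus.ConstrainedCriticalPointLocallyUnique

/-!
# `Balaban1983to89.B15Prop1LocalChartFromThm1AtBase` — [Balaban1985Variational] = «[15]», Thm 1 p. 279 («there exists exactly one orbit … it is a minimum»), (4) p. 278
# (the residual gauge group «u(y) = 1 for y ∈ 𝔅_k»), Prop. 8 p. 305, Sect. F p. 300; [Balaban1988Convergent] = «[III]», (2.10)–(2.12) p. 256; [Balaban1985Averaging] (11) p. 19:
# THE RECORD JUNCTION — the letters `hcritT` AND `hT1u` of the w1 lineage's chart theorem `B15Prop1LocalChartAtBaseField.exists_localChart_at_baseField` DISCHARGED AT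
# `Crit := IsMinimizer` from THEOREM 1 AT THE BASE DATUM + a residual gauge section + [15] Prop. 8 at chart points (the abstract compactness theorem
# `B15Prop1MinimiserFromBaseUniqueness.htransfer_isMin_of_thm1AtBase` instantiated at `SU(2)^{bonds}`, the Wilson action, the `𝐁`-restricted multi-scale averages and the
# residual gauge group; local uniqueness from `ConstrainedCriticalPointLocallyUnique` through the logarithmic datum coordinates)

Honest framing: statement-level skeleton of published theorems with citation tags; proofs where landed; nothing here is a claim about the
Yang–Mills mass gap.  Cell `pub-ymgap`, HUMAN RULING D-0149 (width seats), seat `pub-ymgap-dag-n12-w1` (g3; N12 = [B15]; U1a⁺ of the w1 lineage, rule (ii)); `--kind proof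
--supports` the K1 item of record; count-neutral; N12 NOT discharged; finite 𝕋⁴ at fixed ε; nothing continuum ∕ ℝ⁴ ∕ OS ∕ mass-gap ∕ Clay.

WHY.  `exists_localChart_at_baseField` displays, per base field, SIX letters: `hcrit`, `honto`, `hnondeg` (β), `hclass`, `hcritT` ([15] Sect. F at an abstract `Crit`) and `hT1u` ([15]
Thm 1's uniqueness clause FOR ALL NEARBY DATA).  With `Crit Q' U' := IsMinimizer av reg 𝔹 (avgFamily av Q') U'`, `hT1u` is the identity and `hcritT` follows (§3) from the abstract
`htransfer_isMin_of_thm1AtBase` at the record's objects: `X := GaugeField P 0 SU2` (compact), `A := wilsonAction4` (continuous, gauge invariant: `wilsonAction4_gaugeAct'`),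
`D U := (↑(Ū^{j}(U)(c)))_{(j,c) ∈ constrained bonds of 𝐁}` (§1: `AgreeOn 𝐁 ⟺ D =`, continuous at every guarded configuration by `coeField_iter_eq_iterMh` ∕ `differentiableAt_iterMh`
∕ `eventually_smallBelow`, invariant under RESIDUAL gauge transformations by the covariance `iter_gaugeAct` — [Balaban1985Averaging] (11)), `Res :=` the actions of gauge
transformations trivial at the block-tower sites of the constrained bonds ([15] (4); the (σ4) shape of dag-n12-w6's `B15Prop1AxialGaugeSectionOfForest`), `ι := coeField` (inducing,
injective), `χ x := expMulC ↑x ↑U₀` on the slice, `Â := Re` of the complex Wilson action (`B15Prop1ComplexWilsonAction`), and (U) from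
`ConstrainedCriticalPointLocallyUnique.exists_nhds_critical_unique` for the analytic slice action ∕ slice datum (`analyticAt_sliceAction` ∕ `analyticAt_sliceDatum`) through the
dictionary `Φ₀ x = (logCoordC (W_i⋆ · D(U')_i))_i` at a guarded chart point `χ x = ↑U'`.  AFTER THIS FILE the per-base-field letters of the (J0′)∕(K′) road are: `hcrit`, `honto`,
(β) `hnondeg`, `hclass` (discharged at NODE 00's class by `B15Prop1ClassOpenAtRecord`), and — replacing {(E), `hcritT`, `hT1u`} — (T1@q₀) THEOREM 1 AT THE BASE DATUM («every
configuration of the closed-reading class `reg'` on the base fibre with action `≤ A(U₀)` is a residual translate of `U₀`»), (S) a RESIDUAL GAUGE SECTION near `U₀` into the slice chart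
(dag-n12-w6's (σ1)–(σ4) ∕ forest gauge + `contDiff_pathGaugeAct` supply it — successor junction), (P8) [15] Prop. 8 at chart points (a minimiser `exp(x)·U₀` over `reg`, `x` near `0`, is
Lagrange-critical in the slice coordinates; the base-point case is `B15Prop1BaseCriticalityFromMinimiser.hcrit_of_isMinimizer`), and the three CLASS facts `IsClosed reg'`,
`closure reg ⊆ reg'`, `reg' ⊆ {guarded below k}`.

CONTENTS (theorems only; no `def`, no `instance`, no `sorry`).  §1 `agreeOn_iff_datum_eq`, `datum_gaugeAct_of_residual`, `continuousAt_datum`.  §2 ★★★ `hcritT_isMinimizer_of_thm1AtBase`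
(the `hcritT` binder of `exists_localChart_at_baseField` at `Crit := IsMinimizer`).  §3 ★★★ `exists_localChart_at_baseField_of_thm1AtBase` (the chart theorem with {`hcritT`, `hT1u`} ↦
{(T1@q₀), (S), (P8), class facts}).
HONEST SCOPE: topology ∕ bookkeeping; (T1@q₀), (S), (P8), `hcrit`, `honto`, `hnondeg` stay DISPLAYED as hypotheses — print's analysis, not asserted; count-neutral; N12 NOT discharged; the YM
mass gap (Clay) is NOT proved by any of this — R4 closes only the conditional finite-𝕋⁴ rung `BalabanLadder.UV`.
-/

noncomputable section

namespace Literature.MathematicalPhysics.QuantumFieldTheory.Balaban1983to89.B15Prop1LocalChartFromThm1AtBase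

open Set Metric Filter
open scoped Topology
open Literature.MathematicalPhysics.QuantumFieldTheory.Balaban1983to89.Node00 (SU coeField coeField_apply SmallBelow ConstrSet constrCard constrEnum star_coe_mul_coe_SU)
open B15AveragingHolomorphic (iterMh coeField_iter_eq_iterMh differentiableAt_iterMh)
open B15ComplexifiedDatumFamily (conjVec)
open B15SU2ChartHolomorphic (expMulC logCoordC differentiableAt_logCoordC)
open B15Prop1StateChartSU2 (differentiable_expMulC_right)
open B15Prop1DatumCoordinates (eventually_smallBelow expMulC_zero_left logCoordC_one)
open B15Prop1ComplexWilsonAction (contDiffAt_actionSum actionSum_expMulC_cplxVec)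
open B15Prop1CriticalChartFromIFT (cplxVec_zero)
open B15Prop1ClassOpenAtRecord (isInducing_coeField)
open B15Prop1LocalChartAtBaseField (exists_localChart_at_baseField)
open B15Prop1SliceNondegeneracyFromRealCoercive (analyticAt_sliceAction analyticAt_sliceDatum)
open B15Prop1MinimiserFromBaseUniqueness (htransfer_isMin_of_thm1AtBase)
open Literature.Analysis.Calculus.ConstrainedCriticalPointLocallyUnique (exists_nhds_critical_unique)
open B14Eq16FaddeevPopov (wilsonAction4_gaugeAct')
open B16Thm1BaseAtRecord11 (continuous_wilsonAction4_SU)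
open B12ContinuousTransportInvariance (continuous_gaugeAct_SU)
open B16Sect1Backgrounds (toMS iter_gaugeAct expMul expMul_zero)
open B15Prop1AnalyticExtClause (cplxVec)
open B15Prop1ChartSU2 (su2Chart)
open ExpMeanLog (expMeanLogSU)
open BlockAveraging (blockAvg)
open T4CubeChartGnomonic (SU2)
open T4Continuum B15DeterminingSets GaugeField
open scoped Matrix.Norms.L2Operator

variable {P : Params}

/-! ## §1  The datum vector on the enumerated constrained bonds of `𝐁` -/

section Datum

variable (𝔹 : DetSet P) (k : ℕ)

/-- **`AgreeOn 𝐁` IS EQUALITY OF THE DATUM VECTOR**: for a determining set with no member above level `k`, two multi-scale fields agree on `𝐁` iff their (matrix) values at the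
enumerated constrained bonds of levels `≤ k` coincide ([III] (2.10): «V = V_j on Γ_j»). [cite: Balaban1988Convergent, (2.10) p.256] -/
theorem agreeOn_iff_datum_eq (h𝔹 : ∀ j, k < j → 𝔹 j = ∅) (V W : MSField P SU2) :
    AgreeOn 𝔹 V W ↔
      (fun i : Fin (constrCard 𝔹 k) => ((V ((constrEnum 𝔹 k).symm i).1 ((constrEnum 𝔹 k).symm i).2.1 : SU2) : Matrix (Fin 2) (Fin 2) ℂ)) =
        fun i => ((W ((constrEnum 𝔹 k).symm i).1 ((constrEnum 𝔹 k).symm i).2.1 : SU2) : Matrix (Fin 2) (Fin 2) ℂ) := by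
  constructor
  · intro h
    funext i
    exact congrArg (fun g : SU2 => (g : Matrix (Fin 2) (Fin 2) ℂ)) (h _ _ ((constrEnum 𝔹 k).symm i).2.2)
  · intro heq j c hc
    by_cases hjk : k < j
    · exfalso
      have h0 : 𝔹 j = ∅ := h𝔹 j hjk
      rcases hc with h | h
      · rw [h0] at h; exact h
      · rw [h0] at h; exact h
    · have hj : j ≤ k := Nat.le_of_not_lt hjk
      let s₀ : ConstrSet 𝔹 k := ⟨⟨j, Nat.lt_succ_of_le hj⟩, c, hc⟩
      have hi : ((V ((constrEnum 𝔹 k).symm (constrEnum 𝔹 k s₀)).1 ((constrEnum 𝔹 k).symm (constrEnum 𝔹 k s₀)).2.1 : SU2) : Matrix (Fin 2) (Fin 2) ℂ) =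
          ((W ((constrEnum 𝔹 k).symm (constrEnum 𝔹 k s₀)).1 ((constrEnum 𝔹 k).symm (constrEnum 𝔹 k s₀)).2.1 : SU2) : Matrix (Fin 2) (Fin 2) ℂ) :=
        congrFun heq (constrEnum 𝔹 k s₀)
      rw [Equiv.symm_apply_apply] at hi
      exact Subtype.ext hi

/-- **RESIDUAL GAUGE TRANSFORMATIONS DO NOT MOVE THE DATUM**: if `u = 1` at the block-tower sites of the endpoints of the constrained bonds of levels `≤ k` ([15] (4) «u(y) = 1 for
y ∈ 𝔅_k»; the (σ4) shape), then `Ū^j(U^u)(c) = Ū^j(U)(c)` at every constrained bond, by the gauge covariance of the iterated averages ([Balaban1985Averaging] (11)).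
[cite: Balaban1985Variational, (4) p.278; Balaban1985Averaging, (11) p.19] -/
theorem datum_gaugeAct_of_residual (hk : k ≤ P.m + P.K) (av : ∀ j, Averaging P j SU2) (u : GaugeTransf P 0 SU2)
    (hu : ∀ j, j ≤ k → ∀ b ∈ bondsOf (𝔹 j), toMS u j b.src = 1 ∧ toMS u j b.tgt = 1) (U : GaugeField P 0 SU2) (i : Fin (constrCard 𝔹 k)) :
    avgFamily av (gaugeAct u U) ((constrEnum 𝔹 k).symm i).1 ((constrEnum 𝔹 k).symm i).2.1 =
      avgFamily av U ((constrEnum 𝔹 k).symm i).1 ((constrEnum 𝔹 k).symm i).2.1 := by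
  set s := (constrEnum 𝔹 k).symm i
  have hj : (s.1 : ℕ) ≤ k := Nat.le_of_lt_succ s.1.2
  obtain ⟨hsrc, htgt⟩ := hu s.1 hj s.2.1 s.2.2
  show Averaging.iter av s.1 (gaugeAct u U) s.2.1 = Averaging.iter av s.1 U s.2.1
  rw [iter_gaugeAct av u U s.1 (hj.trans hk)]
  simp only [GaugeField.gaugeAct, hsrc, htgt, one_mul, inv_one, mul_one]

/-- **THE DATUM VECTOR IS CONTINUOUS AT EVERY GUARDED CONFIGURATION** (print: the averages are analytic on the small-field region, [15] Prop. 9): under the (0.4) guard below `k` at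
`U₁`, the guard holds near `U₁` (`eventually_smallBelow`), where `↑(Ū^j U)(c) = iterMh j ↑U c` (`coeField_iter_eq_iterMh`), a continuous function of `U` (`differentiableAt_iterMh`).
[cite: Balaban1985Variational, Prop. 9 p.309; Balaban1987RG1, (0.4) p.253] -/
theorem continuousAt_datum {U₁ : GaugeField P 0 SU2} (hsb : SmallBelow (fun j => blockAvg (P := P) (j := j) expMeanLogSU) k U₁) :
    ContinuousAt (fun (U : GaugeField P 0 SU2) (i : Fin (constrCard 𝔹 k)) =>
      ((avgFamily (fun j => blockAvg (P := P) (j := j) expMeanLogSU) U ((constrEnum 𝔹 k).symm i).1 ((constrEnum 𝔹 k).symm i).2.1 : SU2) :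
        Matrix (Fin 2) (Fin 2) ℂ)) U₁ := by
  refine continuousAt_pi.2 fun i => ?_
  set s := (constrEnum 𝔹 k).symm i
  have hj : (s.1 : ℕ) ≤ k := Nat.le_of_lt_succ s.1.2
  have hcoe : Continuous (coeField : GaugeField P 0 SU2 → PBond P 0 → Matrix (Fin 2) (Fin 2) ℂ) := isInducing_coeField.continuous
  have hev : ∀ᶠ U in 𝓝 U₁, SmallBelow (fun j => blockAvg (P := P) (j := j) expMeanLogSU) k U :=
    (hcoe.continuousAt.eventually (eventually_smallBelow hsb)).mono fun U hU => hU U rfl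
  have heq : (fun U : GaugeField P 0 SU2 => iterMh (s.1 : ℕ) (coeField U) s.2.1) =ᶠ[𝓝 U₁]
      fun U => ((avgFamily (fun j => blockAvg (P := P) (j := j) expMeanLogSU) U s.1 s.2.1 : SU2) : Matrix (Fin 2) (Fin 2) ℂ) :=
    hev.mono fun U hU => by
      have h := congrFun (coeField_iter_eq_iterMh (s.1 : ℕ) (hU.mono hj)) s.2.1
      rw [coeField_apply] at h
      exact h.symm
  have hcont : ContinuousAt (fun U : GaugeField P 0 SU2 => iterMh (s.1 : ℕ) (coeField U) s.2.1) U₁ := by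
    have h1 : ContinuousAt (fun U : GaugeField P 0 SU2 => iterMh (s.1 : ℕ) (coeField U)) U₁ :=
      ContinuousAt.comp (f := coeField) (differentiableAt_iterMh (s.1 : ℕ) (hsb.mono hj)).continuousAt hcoe.continuousAt
    exact ((continuous_apply s.2.1).continuousAt).comp h1
  exact hcont.congr heq

end Datum

/-! ## §2  The criticality transfer at `Crit := IsMinimizer`, from Theorem 1 at the base datum -/

section Transfer

/-- ★★★ **`hcritT` AT `Crit := IsMinimizer` FROM THEOREM 1 AT THE BASE DATUM.**  In the setting of `exists_localChart_at_baseField` (determining set `𝐁` of levels `≤ k ≤ m + K`, class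
`reg`, base datum configuration `Q₀` and base state `U₀` guarded below `k`, `U₀` on the fibre of `Q₀`, conjugation-stable slice `S`, slice action `a` and slice datum coordinates
`Φ₀` characterised pointwise, `hcrit`∕`honto`∕`hnondeg` at `0`, `hclass`), assume the three class facts (`reg'` closed, `closure reg ⊆ reg'`, `reg'` guarded below `k`) and the
three letters (T1@q₀) THEOREM 1 AT THE BASE DATUM, (S) RESIDUAL GAUGE SECTION near `U₀`, (P8) CHART-CRITICALITY OF MINIMISERS at chart points near `0`.  Then the `hcritT` binder of
`exists_localChart_at_baseField` holds with `Crit Q' U' := IsMinimizer av reg 𝐁 (Ū Q') U'`: a Lagrange-critical slice-chart point near `(0, ↑Q₀)` whose configuration lies on the fibre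
of `Q'` IS a minimiser for the datum of `Q'`. [cite: Balaban1985Variational, Thm 1 p.279, (4) p.278, Prop 8 p.305, Sect. F p.300, Prop 9 p.309; Balaban1988Convergent, (2.10)–(2.12) p.256; Balaban1985Averaging, (11) p.19] -/
theorem hcritT_isMinimizer_of_thm1AtBase (𝔹 : DetSet P) (k : ℕ) (hk : k ≤ P.m + P.K) (h𝔹 : ∀ j, k < j → 𝔹 j = ∅) (reg reg' : Set (GaugeField P 0 SU2))
    {Q₀ U₀ : GaugeField P 0 SU2}
    (hsbQ : SmallBelow (fun j => blockAvg (P := P) (j := j) expMeanLogSU) k Q₀)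
    (hsbU : SmallBelow (fun j => blockAvg (P := P) (j := j) expMeanLogSU) k U₀)
    (hU₀ : AgreeOn 𝔹 (avgFamily (fun j => blockAvg (P := P) (j := j) expMeanLogSU) U₀) (avgFamily (fun j => blockAvg (P := P) (j := j) expMeanLogSU) Q₀))
    (S : Submodule ℂ (VecField P 0 (EuclideanSpace ℂ (Fin 3))))
    (a : S → ℂ)
    (ha : ∀ X : S, a X = ∑ p : Plaq P 0, (1 - (expMulC (X : VecField P 0 (EuclideanSpace ℂ (Fin 3))) (coeField U₀) ⟨p.src, p.μ⟩ *
      expMulC (X : VecField P 0 (EuclideanSpace ℂ (Fin 3))) (coeField U₀) ⟨p.src.shift p.μ, p.ν⟩ *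
      Matrix.adjugate (expMulC (X : VecField P 0 (EuclideanSpace ℂ (Fin 3))) (coeField U₀) ⟨p.src.shift p.ν, p.μ⟩) *
      Matrix.adjugate (expMulC (X : VecField P 0 (EuclideanSpace ℂ (Fin 3))) (coeField U₀) ⟨p.src, p.ν⟩)).trace / 2))
    (Φ₀ : S → Fin (constrCard 𝔹 k) → EuclideanSpace ℂ (Fin 3))
    (hΦ₀ : ∀ (X : S) i, Φ₀ X i = logCoordC (star ((avgFamily (fun j => blockAvg (P := P) (j := j) expMeanLogSU) Q₀ ((constrEnum 𝔹 k).symm i).1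
      ((constrEnum 𝔹 k).symm i).2.1 : SU2) : Matrix (Fin 2) (Fin 2) ℂ) *
      iterMh ((constrEnum 𝔹 k).symm i).1 (expMulC (X : VecField P 0 (EuclideanSpace ℂ (Fin 3))) (coeField U₀)) ((constrEnum 𝔹 k).symm i).2.1))
    {ℓ₀ : (Fin (constrCard 𝔹 k) → EuclideanSpace ℂ (Fin 3)) →L[ℂ] ℂ}
    (hcrit : fderiv ℂ a 0 = ℓ₀.comp (fderiv ℂ Φ₀ 0))
    (honto : Function.Surjective (fderiv ℂ Φ₀ 0))
    (hnondeg : ∀ s : S, fderiv ℂ Φ₀ 0 s = 0 →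
      (∀ t : S, fderiv ℂ Φ₀ 0 t = 0 → fderiv ℂ (fderiv ℂ a) 0 s t - ℓ₀ (fderiv ℂ (fderiv ℂ Φ₀) 0 s t) = 0) → s = 0)
    (hclass : ∀ᶠ Q in 𝓝 (coeField U₀), ∀ U' : GaugeField P 0 SU2, coeField U' = Q → U' ∈ reg)
    -- the three CLASS facts: the closed-reading class `reg'`
    (hreg' : IsClosed reg') (hcl : closure reg ⊆ reg')
    (hreg'sb : ∀ U ∈ reg', SmallBelow (fun j => blockAvg (P := P) (j := j) expMeanLogSU) k U)
    -- DISPLAYED (T1@q₀): Theorem 1 at the base datum — the residual orbit of `U₀` is the unique minimal orbit over `reg'`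
    (hT1 : ∀ U ∈ reg', AgreeOn 𝔹 (avgFamily (fun j => blockAvg (P := P) (j := j) expMeanLogSU) U) (avgFamily (fun j => blockAvg (P := P) (j := j) expMeanLogSU) Q₀) →
      wilsonAction4 U ≤ wilsonAction4 U₀ →
        ∃ u : GaugeTransf P 0 SU2, (∀ j, j ≤ k → ∀ b ∈ bondsOf (𝔹 j), toMS u j b.src = 1 ∧ toMS u j b.tgt = 1) ∧ gaugeAct u U = U₀)
    -- DISPLAYED (S): a residual gauge section near `U₀` into the slice chart
    (hSec : ∀ 𝒪 ∈ 𝓝 (0 : S), ∀ᶠ U in 𝓝 U₀, ∃ u : GaugeTransf P 0 SU2, (∀ j, j ≤ k → ∀ b ∈ bondsOf (𝔹 j), toMS u j b.src = 1 ∧ toMS u j b.tgt = 1) ∧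
      ∃ x ∈ 𝒪, coeField (gaugeAct u U) = expMulC ((x : S) : VecField P 0 (EuclideanSpace ℂ (Fin 3))) (coeField U₀))
    -- DISPLAYED (P8): a minimiser over `reg` at a chart point near `0` is Lagrange-critical in the slice coordinates
    (hP8 : ∀ᶠ x in 𝓝 (0 : S), ∀ U' : GaugeField P 0 SU2, expMulC ((x : S) : VecField P 0 (EuclideanSpace ℂ (Fin 3))) (coeField U₀) = coeField U' →
      IsMinimizer (fun j => blockAvg (P := P) (j := j) expMeanLogSU) reg 𝔹 (avgFamily (fun j => blockAvg (P := P) (j := j) expMeanLogSU) U') U' →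
        ∃ μ : (Fin (constrCard 𝔹 k) → EuclideanSpace ℂ (Fin 3)) →L[ℂ] ℂ, fderiv ℂ a x = μ.comp (fderiv ℂ Φ₀ x)) :
    ∀ᶠ w in 𝓝 ((0 : S), coeField Q₀), ∀ (U' Q' : GaugeField P 0 SU2) (μ : (Fin (constrCard 𝔹 k) → EuclideanSpace ℂ (Fin 3)) →L[ℂ] ℂ),
      expMulC (w.1 : VecField P 0 (EuclideanSpace ℂ (Fin 3))) (coeField U₀) = coeField U' → coeField Q' = w.2 →
        AgreeOn 𝔹 (avgFamily (fun j => blockAvg (P := P) (j := j) expMeanLogSU) U') (avgFamily (fun j => blockAvg (P := P) (j := j) expMeanLogSU) Q') →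
        fderiv ℂ a w.1 = μ.comp (fderiv ℂ Φ₀ w.1) →
          IsMinimizer (fun j => blockAvg (P := P) (j := j) expMeanLogSU) reg 𝔹 (avgFamily (fun j => blockAvg (P := P) (j := j) expMeanLogSU) Q') U' := by
  haveI : CompactSpace (GaugeField P 0 SU2) := inferInstanceAs (CompactSpace (PBond P 0 → SU2))
  -- the objects of the abstract theorem
  set av : ∀ j, Averaging P j SU2 := fun j => blockAvg (P := P) (j := j) expMeanLogSU with hav
  obtain ⟨D, hD⟩ : ∃ D : GaugeField P 0 SU2 → Fin (constrCard 𝔹 k) → Matrix (Fin 2) (Fin 2) ℂ,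
      D = fun U i => ((avgFamily av U ((constrEnum 𝔹 k).symm i).1 ((constrEnum 𝔹 k).symm i).2.1 : SU2) : Matrix (Fin 2) (Fin 2) ℂ) := ⟨_, rfl⟩
  have hDagree : ∀ V W : GaugeField P 0 SU2, AgreeOn 𝔹 (avgFamily av V) (avgFamily av W) ↔ D V = D W := fun V W => by
    rw [hD]; exact agreeOn_iff_datum_eq 𝔹 k h𝔹 _ _
  obtain ⟨Res, hRes⟩ : ∃ Res : Set (GaugeField P 0 SU2 → GaugeField P 0 SU2),
      Res = {g | ∃ u : GaugeTransf P 0 SU2, (∀ j, j ≤ k → ∀ b ∈ bondsOf (𝔹 j), toMS u j b.src = 1 ∧ toMS u j b.tgt = 1) ∧ g = gaugeAct u} := ⟨_, rfl⟩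
  obtain ⟨AC, hAC⟩ : ∃ AC : (PBond P 0 → Matrix (Fin 2) (Fin 2) ℂ) → ℂ, ∀ W, AC W = ∑ p : Plaq P 0, (1 - (W ⟨p.src, p.μ⟩ * W ⟨p.src.shift p.μ, p.ν⟩ *
      Matrix.adjugate (W ⟨p.src.shift p.ν, p.μ⟩) * Matrix.adjugate (W ⟨p.src, p.ν⟩)).trace / 2) := ⟨_, fun _ => rfl⟩
  set χ : S → PBond P 0 → Matrix (Fin 2) (Fin 2) ℂ := fun x => expMulC (x : VecField P 0 (EuclideanSpace ℂ (Fin 3))) (coeField U₀) with hχdef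
  -- topology of the objects
  have hcoe : Continuous (coeField : GaugeField P 0 SU2 → PBond P 0 → Matrix (Fin 2) (Fin 2) ℂ) := isInducing_coeField.continuous
  have hιinj : Function.Injective (coeField : GaugeField P 0 SU2 → PBond P 0 → Matrix (Fin 2) (Fin 2) ℂ) := fun U V h =>
    funext fun b => Subtype.ext (by simpa only [coeField_apply] using congrFun h b)
  have hA : Continuous (wilsonAction4 : GaugeField P 0 SU2 → ℝ) := continuous_wilsonAction4_SU (N := 2) (P := P) (j := 0)
  have hDon : ContinuousOn D reg' := fun U hU => by
    rw [hD]; exact (continuousAt_datum 𝔹 k (hreg'sb U hU)).continuousWithinAt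
  have hDQ₀ : ContinuousAt D Q₀ := by rw [hD]; exact continuousAt_datum 𝔹 k hsbQ
  have hχc : ContinuousAt χ 0 := ((differentiable_expMulC_right (coeField U₀)).continuous.comp continuous_subtype_val).continuousAt
  have hχ₀ : χ 0 = coeField U₀ := by
    show expMulC ((0 : S) : VecField P 0 (EuclideanSpace ℂ (Fin 3))) (coeField U₀) = coeField U₀
    rw [Submodule.coe_zero, expMulC_zero_left]
  have hÂ : ContinuousAt (fun W => (AC W).re) (coeField U₀) :=
    Complex.continuous_re.continuousAt.comp (contDiffAt_actionSum hAC (coeField U₀) (n := 0)).continuousAt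
  have hÂι : ∀ U : GaugeField P 0 SU2, (AC (coeField U)).re = wilsonAction4 U := fun U => by
    have h := actionSum_expMulC_cplxVec hAC U (0 : VecField P 0 B15Prop1ChartCalculusSU2.E3)
    rw [cplxVec_zero, expMulC_zero_left, expMul_zero] at h
    rw [h, Complex.ofReal_re]
  have hU₀Q₀ : D U₀ = D Q₀ := (hDagree U₀ Q₀).1 hU₀
  have hres : ∀ g ∈ Res, Continuous g ∧ (∀ U, wilsonAction4 (g U) = wilsonAction4 U) ∧ (∀ U, D (g U) = D U) := by
    rintro g hg
    rw [hRes] at hg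
    obtain ⟨u, hu, rfl⟩ := hg
    refine ⟨continuous_gaugeAct_SU (N := 2) (P := P) (j := 0) u, fun U => wilsonAction4_gaugeAct' u U, fun U => ?_⟩
    rw [hD]
    funext i
    exact congrArg (fun g : SU2 => (g : Matrix (Fin 2) (Fin 2) ℂ)) (datum_gaugeAct_of_residual 𝔹 k hk av u hu U i)
  -- (T1@q₀) in datum currency
  have hT1' : ∀ U ∈ reg', D U = D U₀ → wilsonAction4 U ≤ wilsonAction4 U₀ → ∃ g ∈ Res, g U = U₀ := by
    intro U hU hDU hAU
    have hagree : AgreeOn 𝔹 (avgFamily av U) (avgFamily av Q₀) := (hDagree U Q₀).2 (hDU.trans hU₀Q₀)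
    obtain ⟨u, hu, huU⟩ := hT1 U hU hagree hAU
    exact ⟨gaugeAct u, by rw [hRes]; exact ⟨u, hu, rfl⟩, huU⟩
  -- (S) in the abstract shape
  have hS' : ∀ 𝒪 ∈ 𝓝 (0 : S), ∀ᶠ U in 𝓝 U₀, ∃ g ∈ Res, ∃ x ∈ 𝒪, coeField (g U) = χ x := by
    intro 𝒪 h𝒪
    filter_upwards [hSec 𝒪 h𝒪] with U hU
    obtain ⟨u, hu, x, hx, hux⟩ := hU
    exact ⟨gaugeAct u, by rw [hRes]; exact ⟨u, hu, rfl⟩, x, hx, hux⟩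
  -- (P8) in the abstract shape
  have hP8' : ∀ᶠ x in 𝓝 (0 : S), ∀ U' : GaugeField P 0 SU2, χ x = coeField U' →
      (U' ∈ reg ∧ ∀ V ∈ reg, D V = D U' → wilsonAction4 U' ≤ wilsonAction4 V) →
        ∃ μ : (Fin (constrCard 𝔹 k) → EuclideanSpace ℂ (Fin 3)) →L[ℂ] ℂ, fderiv ℂ a x = μ.comp (fderiv ℂ Φ₀ x) := by
    filter_upwards [hP8] with x hx U' hχU' hmin
    refine hx U' hχU' ⟨hmin.1, fun j b _ => rfl, fun V hV hVU => hmin.2 V hV ((hDagree V U').1 hVU)⟩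
  -- (U): local uniqueness of chart-critical points, through the logarithmic datum coordinates
  have huniq' : ∃ 𝒪 ∈ 𝓝 (0 : S), ∃ 𝒬 ∈ 𝓝 (D U₀), ∀ (U' U'' : GaugeField P 0 SU2) (x x' : S), x ∈ 𝒪 → x' ∈ 𝒪 → χ x = coeField U' → χ x' = coeField U'' →
      D U' ∈ 𝒬 → D U'' = D U' → (∃ μ : (Fin (constrCard 𝔹 k) → EuclideanSpace ℂ (Fin 3)) →L[ℂ] ℂ, fderiv ℂ a x = μ.comp (fderiv ℂ Φ₀ x)) →
      (∃ μ : (Fin (constrCard 𝔹 k) → EuclideanSpace ℂ (Fin 3)) →L[ℂ] ℂ, fderiv ℂ a x' = μ.comp (fderiv ℂ Φ₀ x')) → x = x' := by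
    -- the generic uniqueness theorem for the analytic Lagrange system `(a, Φ₀)` at `0`
    have ha2 : ContDiffAt ℂ ((1 : WithTop ℕ∞) + 1) a 0 := (analyticAt_sliceAction S ha 0).contDiffAt
    have hΦ2 : ContDiffAt ℂ ((1 : WithTop ℕ∞) + 1) Φ₀ 0 := (analyticAt_sliceDatum S 𝔹 k _ hsbU hU₀ hΦ₀).contDiffAt
    obtain ⟨O, hO, V, hV, huniq⟩ := exists_nhds_critical_unique (𝕜 := ℂ) (m := 1) one_ne_zero ha2 hΦ2 hcrit honto hnondeg
    -- the coordinates as a function of the datum vector: `κ̂ q = (logCoordC (W_i⋆ · q_i))_i`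
    obtain ⟨κ, hκ⟩ : ∃ κ : (Fin (constrCard 𝔹 k) → Matrix (Fin 2) (Fin 2) ℂ) → Fin (constrCard 𝔹 k) → EuclideanSpace ℂ (Fin 3),
        ∀ q i, κ q i = logCoordC (star ((avgFamily av Q₀ ((constrEnum 𝔹 k).symm i).1 ((constrEnum 𝔹 k).symm i).2.1 : SU2) : Matrix (Fin 2) (Fin 2) ℂ) * q i) :=
      ⟨_, fun _ _ => rfl⟩
    -- at a guarded chart point, `Φ₀ x = κ̂ (D U')`
    have hΦD : ∀ (x : S) (U' : GaugeField P 0 SU2), χ x = coeField U' → SmallBelow av k U' → Φ₀ x = κ (D U') := by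
      intro x U' hχU' hsb'
      have hx : expMulC (x : VecField P 0 (EuclideanSpace ℂ (Fin 3))) (coeField U₀) = coeField U' := hχU'
      funext i
      have hj : (((constrEnum 𝔹 k).symm i).1 : ℕ) ≤ k := Nat.le_of_lt_succ ((constrEnum 𝔹 k).symm i).1.2
      have hi : iterMh (((constrEnum 𝔹 k).symm i).1 : ℕ) (coeField U') ((constrEnum 𝔹 k).symm i).2.1 =
          ((avgFamily av U' ((constrEnum 𝔹 k).symm i).1 ((constrEnum 𝔹 k).symm i).2.1 : SU2) : Matrix (Fin 2) (Fin 2) ℂ) := by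
        have h := congrFun (coeField_iter_eq_iterMh (((constrEnum 𝔹 k).symm i).1 : ℕ) (hsb'.mono hj)) ((constrEnum 𝔹 k).symm i).2.1
        rw [coeField_apply] at h
        exact h.symm
      rw [hΦ₀, hκ, hD, hx, hi]
    -- `κ̂` is continuous at the base datum vector and `κ̂ (D U₀) = Φ₀ 0`
    have hκD₀ : κ (D U₀) = Φ₀ 0 := (hΦD 0 U₀ hχ₀ hsbU).symm
    have hκc : ContinuousAt κ (D U₀) := by
      refine continuousAt_pi.2 fun i => ?_
      have hfun : (fun q => κ q i) = fun q : Fin (constrCard 𝔹 k) → Matrix (Fin 2) (Fin 2) ℂ =>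
          logCoordC (star ((avgFamily av Q₀ ((constrEnum 𝔹 k).symm i).1 ((constrEnum 𝔹 k).symm i).2.1 : SU2) : Matrix (Fin 2) (Fin 2) ℂ) * q i) :=
        funext fun q => hκ q i
      rw [hfun]
      have hone : star ((avgFamily av Q₀ ((constrEnum 𝔹 k).symm i).1 ((constrEnum 𝔹 k).symm i).2.1 : SU2) : Matrix (Fin 2) (Fin 2) ℂ) * D U₀ i = 1 := by
        rw [hD]
        show star _ * ((avgFamily av U₀ _ _ : SU2) : Matrix (Fin 2) (Fin 2) ℂ) = 1
        rw [hU₀ _ _ ((constrEnum 𝔹 k).symm i).2.2, star_coe_mul_coe_SU]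
      have hlog : ContinuousAt logCoordC (star ((avgFamily av Q₀ ((constrEnum 𝔹 k).symm i).1 ((constrEnum 𝔹 k).symm i).2.1 : SU2) : Matrix (Fin 2) (Fin 2) ℂ) * D U₀ i) := by
        rw [hone]
        exact (differentiableAt_logCoordC (by rw [sub_self, norm_zero]; exact one_pos)).continuousAt
      have hq : ContinuousAt (fun q : Fin (constrCard 𝔹 k) → Matrix (Fin 2) (Fin 2) ℂ => q i) (D U₀) := (continuous_apply i).continuousAt
      have hmul : ContinuousAt (fun q : Fin (constrCard 𝔹 k) → Matrix (Fin 2) (Fin 2) ℂ =>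
          star ((avgFamily av Q₀ ((constrEnum 𝔹 k).symm i).1 ((constrEnum 𝔹 k).symm i).2.1 : SU2) : Matrix (Fin 2) (Fin 2) ℂ) * q i) (D U₀) :=
        continuousAt_const.mul hq
      exact ContinuousAt.comp_of_eq (g := logCoordC)
        (f := fun q : Fin (constrCard 𝔹 k) → Matrix (Fin 2) (Fin 2) ℂ =>
          star ((avgFamily av Q₀ ((constrEnum 𝔹 k).symm i).1 ((constrEnum 𝔹 k).symm i).2.1 : SU2) : Matrix (Fin 2) (Fin 2) ℂ) * q i) hlog hmul rfl
    have h𝒬 : κ ⁻¹' O ∈ 𝓝 (D U₀) := hκc.preimage_mem_nhds (by rw [hκD₀]; exact hO)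
    -- the guard at chart points near `0`
    have hguard : ∀ᶠ x in 𝓝 (0 : S), ∀ U' : GaugeField P 0 SU2, χ x = coeField U' → SmallBelow av k U' := by
      have h := eventually_smallBelow hsbU
      rw [← hχ₀] at h
      filter_upwards [hχc.eventually h] with x hx U' hU'
      exact hx U' hU'.symm
    refine ⟨V ∩ {x | ∀ U' : GaugeField P 0 SU2, χ x = coeField U' → SmallBelow av k U'}, inter_mem hV hguard, κ ⁻¹' O, h𝒬,
      fun U' U'' x x' hx hx' hχU' hχU'' hDU' hDU'' hc hc' => ?_⟩
    obtain ⟨μ, hμ⟩ := hc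
    obtain ⟨μ', hμ'⟩ := hc'
    have hΦx : Φ₀ x = κ (D U') := hΦD x U' hχU' (hx.2 U' hχU')
    have hΦx' : Φ₀ x' = κ (D U') := by rw [← hDU'']; exact hΦD x' U'' hχU'' (hx'.2 U'' hχU'')
    exact huniq (κ (D U')) hDU' x hx.1 x' hx'.1 μ μ' hμ hΦx hμ' hΦx'
  -- the abstract theorem
  have key := htransfer_isMin_of_thm1AtBase (X := GaugeField P 0 SU2) (reg := reg) (reg' := reg') (Res := Res) (U₀ := U₀) (Q₀ := Q₀)
    (ι := coeField) (χ := χ) (x₀ := 0) (Â := fun W => (AC W).re)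
    (LCrit := fun x : S => ∃ μ : (Fin (constrCard 𝔹 k) → EuclideanSpace ℂ (Fin 3)) →L[ℂ] ℂ, fderiv ℂ a x = μ.comp (fderiv ℂ Φ₀ x))
    (A := wilsonAction4) (D := D) hA hreg' hDon hDQ₀ hcl hres hT1' isInducing_coeField hιinj hχc hχ₀ hÂ hÂι hU₀Q₀ hclass hS' hP8' huniq'
  filter_upwards [key] with w hw U' Q' μ hχU' hQ' hagree hμ
  obtain ⟨hreg, hDU', hmin⟩ := hw U' Q' hχU' hQ' ((hDagree U' Q').1 hagree) ⟨μ, hμ⟩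
  exact ⟨hreg, hagree, fun V hV hVQ => hmin V hV ((hDagree V Q').1 hVQ)⟩

end Transfer

/-! ## §3  The chart theorem with {`hcritT`, `hT1u`} replaced by Theorem 1 at the base datum, the gauge section and Prop. 8 -/

section Chart

/-- ★★★ **THE LOCAL HOLOMORPHIC MINIMISER CHART AT ONE BASE FIELD FROM THEOREM 1 AT THE BASE DATUM.**  `B15Prop1LocalChartAtBaseField.exists_localChart_at_baseField` with its two
letters `hcritT` ([15] Sect. F at an abstract `Crit`) and `hT1u` ([15] Thm 1's uniqueness clause for ALL nearby data) REPLACED by: the three class facts (`reg'` closed, `closure reg ⊆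
reg'`, `reg'` guarded below `k`), (T1@q₀) THEOREM 1 AT THE BASE DATUM (the residual orbit of `U₀` is the unique minimal orbit over `reg'` on the base fibre), (S) a RESIDUAL GAUGE
SECTION near `U₀` into the slice chart, (P8) [15] Prop. 8 at chart points; plus `k ≤ m + K` (gauge covariance of the averages).  Same conclusion: an open `O ∋ ↑Q₀` and a bounded
holomorphic matrix family `Γ` on `O` whose value at every `SU(2)` datum `Q' ∈ O` is a MINIMISER for the datum of `Q'`.  Proof: `Crit := IsMinimizer`, `hT1u := id`,
`hcritT := hcritT_isMinimizer_of_thm1AtBase`. [cite: Balaban1985Variational, Thm 1 p.279, (4) p.278, Sect. C (47)–(48) p.285, Sect. F p.300, Prop 8 p.305, Sect. G pp.305–307, Prop 9 (190) p.309; Balaban1988Convergent, (2.10)–(2.12) p.256; Balaban1989LargeFieldI, Prop. 1 p.194 (last clause); LuenbergerYe2008, §10.7 pp.306–307] -/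
theorem exists_localChart_at_baseField_of_thm1AtBase (𝔹 : DetSet P) (k : ℕ) (hk : k ≤ P.m + P.K) (h𝔹 : ∀ j, k < j → 𝔹 j = ∅) (reg : Set (GaugeField P 0 SU2))
    {Q₀ U₀ : GaugeField P 0 SU2}
    (hsbQ : SmallBelow (fun j => blockAvg (P := P) (j := j) expMeanLogSU) k Q₀)
    (hsbU : SmallBelow (fun j => blockAvg (P := P) (j := j) expMeanLogSU) k U₀)
    (hU₀ : AgreeOn 𝔹 (avgFamily (fun j => blockAvg (P := P) (j := j) expMeanLogSU) U₀) (avgFamily (fun j => blockAvg (P := P) (j := j) expMeanLogSU) Q₀))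
    -- the gauge slice
    (S : Submodule ℂ (VecField P 0 (EuclideanSpace ℂ (Fin 3)))) (hS : ∀ X ∈ S, conjVec X ∈ S)
    -- the action and the constraint coordinates on the slice, characterised pointwise
    (a : S → ℂ)
    (ha : ∀ X : S, a X = ∑ p : Plaq P 0, (1 - (expMulC (X : VecField P 0 (EuclideanSpace ℂ (Fin 3))) (coeField U₀) ⟨p.src, p.μ⟩ *
      expMulC (X : VecField P 0 (EuclideanSpace ℂ (Fin 3))) (coeField U₀) ⟨p.src.shift p.μ, p.ν⟩ *
      Matrix.adjugate (expMulC (X : VecField P 0 (EuclideanSpace ℂ (Fin 3))) (coeField U₀) ⟨p.src.shift p.ν, p.μ⟩) *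
      Matrix.adjugate (expMulC (X : VecField P 0 (EuclideanSpace ℂ (Fin 3))) (coeField U₀) ⟨p.src, p.ν⟩)).trace / 2))
    (Φ₀ : S → Fin (constrCard 𝔹 k) → EuclideanSpace ℂ (Fin 3))
    (hΦ₀ : ∀ (X : S) i, Φ₀ X i = logCoordC (star ((avgFamily (fun j => blockAvg (P := P) (j := j) expMeanLogSU) Q₀ ((constrEnum 𝔹 k).symm i).1
      ((constrEnum 𝔹 k).symm i).2.1 : SU2) : Matrix (Fin 2) (Fin 2) ℂ) *
      iterMh ((constrEnum 𝔹 k).symm i).1 (expMulC (X : VecField P 0 (EuclideanSpace ℂ (Fin 3))) (coeField U₀)) ((constrEnum 𝔹 k).symm i).2.1))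
    -- DISPLAYED: Lagrange criticality of the base state, «onto», (β) nondegeneracy — in these coordinates
    {ℓ₀ : (Fin (constrCard 𝔹 k) → EuclideanSpace ℂ (Fin 3)) →L[ℂ] ℂ}
    (hcrit : fderiv ℂ a 0 = ℓ₀.comp (fderiv ℂ Φ₀ 0))
    (honto : Function.Surjective (fderiv ℂ Φ₀ 0))
    (hnondeg : ∀ s : S, fderiv ℂ Φ₀ 0 s = 0 →
      (∀ t : S, fderiv ℂ Φ₀ 0 t = 0 → fderiv ℂ (fderiv ℂ a) 0 s t - ℓ₀ (fderiv ℂ (fderiv ℂ Φ₀) 0 s t) = 0) → s = 0)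
    -- DISPLAYED: the class is open at `U₀`; criticality transfer; [15] Thm 1's uniqueness clause
    (hclass : ∀ᶠ Q in 𝓝 (coeField U₀), ∀ U' : GaugeField P 0 SU2, coeField U' = Q → U' ∈ reg)
    -- the three CLASS facts: the closed-reading class `reg'`
    (reg' : Set (GaugeField P 0 SU2)) (hreg' : IsClosed reg') (hcl : closure reg ⊆ reg')
    (hreg'sb : ∀ U ∈ reg', SmallBelow (fun j => blockAvg (P := P) (j := j) expMeanLogSU) k U)
    -- DISPLAYED (T1@q₀): Theorem 1 at the base datum — the residual orbit of `U₀` is the unique minimal orbit over `reg'`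
    (hT1 : ∀ U ∈ reg', AgreeOn 𝔹 (avgFamily (fun j => blockAvg (P := P) (j := j) expMeanLogSU) U) (avgFamily (fun j => blockAvg (P := P) (j := j) expMeanLogSU) Q₀) →
      wilsonAction4 U ≤ wilsonAction4 U₀ →
        ∃ u : GaugeTransf P 0 SU2, (∀ j, j ≤ k → ∀ b ∈ bondsOf (𝔹 j), toMS u j b.src = 1 ∧ toMS u j b.tgt = 1) ∧ gaugeAct u U = U₀)
    -- DISPLAYED (S): a residual gauge section near `U₀` into the slice chart
    (hSec : ∀ 𝒪 ∈ 𝓝 (0 : S), ∀ᶠ U in 𝓝 U₀, ∃ u : GaugeTransf P 0 SU2, (∀ j, j ≤ k → ∀ b ∈ bondsOf (𝔹 j), toMS u j b.src = 1 ∧ toMS u j b.tgt = 1) ∧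
      ∃ x ∈ 𝒪, coeField (gaugeAct u U) = expMulC ((x : S) : VecField P 0 (EuclideanSpace ℂ (Fin 3))) (coeField U₀))
    -- DISPLAYED (P8): a minimiser over `reg` at a chart point near `0` is Lagrange-critical in the slice coordinates
    (hP8 : ∀ᶠ x in 𝓝 (0 : S), ∀ U' : GaugeField P 0 SU2, expMulC ((x : S) : VecField P 0 (EuclideanSpace ℂ (Fin 3))) (coeField U₀) = coeField U' →
      IsMinimizer (fun j => blockAvg (P := P) (j := j) expMeanLogSU) reg 𝔹 (avgFamily (fun j => blockAvg (P := P) (j := j) expMeanLogSU) U') U' →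
        ∃ μ : (Fin (constrCard 𝔹 k) → EuclideanSpace ℂ (Fin 3)) →L[ℂ] ℂ, fderiv ℂ a x = μ.comp (fderiv ℂ Φ₀ x))
    {𝓐₀ : ℝ} (h𝓐₀ : 1 < 𝓐₀) :
    ∃ O : Set (PBond P 0 → Matrix (Fin 2) (Fin 2) ℂ), IsOpen O ∧ coeField Q₀ ∈ O ∧
      ∃ Γ : (PBond P 0 → Matrix (Fin 2) (Fin 2) ℂ) → PBond P 0 → Matrix (Fin 2) (Fin 2) ℂ,
        (∀ b i j, DifferentiableOn ℂ (fun Q => Γ Q b i j) O) ∧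
        (∀ Q ∈ O, ∀ b i j, ‖Γ Q b i j‖ ≤ 𝓐₀) ∧
        ∀ Q' : GaugeField P 0 SU2, coeField Q' ∈ O →
          ∃ U' : GaugeField P 0 SU2, (∀ b, Γ (coeField Q') b = ((U' b : SU2) : Matrix (Fin 2) (Fin 2) ℂ)) ∧
            IsMinimizer (fun j => blockAvg (P := P) (j := j) expMeanLogSU) reg 𝔹 (avgFamily (fun j => blockAvg (P := P) (j := j) expMeanLogSU) Q') U' :=
  exists_localChart_at_baseField 𝔹 k h𝔹 reg hsbQ hsbU hU₀ S hS a ha Φ₀ hΦ₀ hcrit honto hnondeg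
    (fun Q' U' => IsMinimizer (fun j => blockAvg (P := P) (j := j) expMeanLogSU) reg 𝔹 (avgFamily (fun j => blockAvg (P := P) (j := j) expMeanLogSU) Q') U')
    hclass
    (hcritT_isMinimizer_of_thm1AtBase 𝔹 k hk h𝔹 reg reg' hsbQ hsbU hU₀ S a ha Φ₀ hΦ₀ hcrit honto hnondeg hclass hreg' hcl hreg'sb hT1 hSec hP8)
    (Filter.Eventually.of_forall fun _ _ _ _ _ _ h => h) h𝓐₀

end Chart


end Literature.MathematicalPhysics.QuantumFieldTheory.Balaban1983to89.B15Prop1LocalChartFromThm1AtBase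

end
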